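import Summits.ABC.ABC.Theses.RibetTakahashiSplit
import Summits.ABC.ABC.Theorems.RibetTakahashiSplitDiscrepancyPotentialBoundCounting
import Summits.ABC.ABC.Theorems.RibetTakahashiSplitDiscrepancyPotentialBoundIntegrals

/-!
# Route RibetTakahashiSplit — item `DiscrepancyPotentialBound` (stmt-ABC-2637):
  Serre's log-gas lemma

We prove `Summit.ABC.ABC.Theses.RibetTakahashiSplit.DiscrepancyPotentialBound`
(`discrepancyPotentialBound_proof`): for `ℓ ≥ 2` and `ε > 0` there is `δ > 0` such that for
all points `x₁, …, xₙ ∈ [-2√ℓ, 2√ℓ]` whose Kolmogorov discrepancy to the unnormalised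
Kesten–McKay law `dμ_ℓ = (ℓ+1)√(4ℓ - t²) dt / (2π((ℓ+1)² - t²))` is `≤ δ` on every closed
interval `[α, β]`, and every `|a| ≤ 2√ℓ`,
`(1/n) Σ_{xᵢ ≠ a} log |a - xᵢ| ≤ ∫_{-2√ℓ}^{2√ℓ} log|a - t| dμ_ℓ(t) + ε`.

## Proof

A one-sided discretised layer-cake (Koksma-type) comparison, uniform in `a`.  Put `L = 2√ℓ`,
`M = log (2L) + 1`, `R = (ℓ+1)·2√ℓ ≥ ρ`, choose `K ≥ 0` with `2R e^{-K} ≤ ε/4`, `N` with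
`h = (M+K)/N ≤ ε/8`, and `δ = min 1 (ε / (8(M+K)))`.  With radii `e_k = e^{M-(k+1)h}`, the step
function `ψ = M - h Σ_{k<N} 1_{[a-e_k, a+e_k]}` dominates `log|a - ·|` away from `a` and equals
`-K` at `a`; hence (part 1) `(1/n)Σ_{xᵢ≠a} log|a-xᵢ| ≤ M∫_{-L}^{L}ρ - hΣ_k ∫_{a-e_k}^{a+e_k}ρ
+ 2(M+K)δ`, using the discrepancy hypothesis on `N + 2` closed intervals only (the total mass of
`μ_ℓ` is never needed).  By part 2 the main term is `∫_{-L}^{L} ψρ ≤ ∫ log|a-t| ρ + h∫ρ + 2Re^{-K}`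
since `ψ ≤ log|a-t| + h + (-K - log|a-t|)⁺` pointwise; finally `∫_{-L}^{L} ρ ≤ 1 + δ ≤ 2` again by
discrepancy.  `avg_log_le_potential` is this statement for an abstract density; the four
`km_density_*` lemmas verify its hypotheses for the Kesten–McKay density (nonnegativity and the
vanishing off `(-L, L)` use Lean's conventions `√x = 0` for `x ≤ 0`, `y/0 = 0`, exactly as in
the route statement).

Sources: the informal statement is item S1 of idea card `serre-potential-log-free-szpiro`
(Serre 1997 equidistribution, Murty–Sinha 2009 Thm 2/Thm 9 for the use); the argument is the
standard proof of Koksma's inequality for a function of bounded variation, cut to the upper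
bound (Kuipers–Niederreiter Ch. 2 Thm 5.1), and needs no named fact.
-/

-- `Summit.<Summit>.<Problem>` is the mandated summit-side namespace (CONVENTIONS §2); for the
-- single-conjunct summit `ABC` the two coincide, so the duplicate `ABC.ABC` is deliberate.
set_option linter.dupNamespace false

open MeasureTheory Set intervalIntegral Real Finset

namespace Summit.ABC.ABC.Theorems

namespace DiscrepancyPotentialBound

/-! ### The abstract one-sided Koksma bound -/

/-- Abstract bound: for a density `ρ` on `[-L, L]` with `0 ≤ ρ ≤ R`, vanishing off `(-L, L)` and
continuous on `[-L, L]`, points of Kolmogorov discrepancy `≤ δ` have average truncated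
logarithmic potential at most `∫ log|a-t| ρ + h(1+δ) + 2R e^{-K} + 2(M+K)δ`, `h = (M+K)/N`. -/
theorem avg_log_le_potential {n N : ℕ} {M K h L R δ : ℝ} (ρ : ℝ → ℝ) (x : Fin n → ℝ) (a : ℝ)
    (hn : 0 < n) (hN : 0 < N) (hh : h = (M + K) / N) (hMK : 0 < M + K) (hK : 0 ≤ K)
    (hM0 : 0 ≤ M) (hLM : Real.log (2 * L) ≤ M) (hL : 0 ≤ L) (hR : 0 ≤ R)
    (hρ0 : ∀ t, 0 ≤ ρ t) (hρR : ∀ t, ρ t ≤ R) (hρoff : ∀ t, t ∉ Set.Ioo (-L) L → ρ t = 0)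
    (hρc : ContinuousOn ρ (Set.Icc (-L) L))
    (hx : ∀ i, |x i| ≤ L) (ha : |a| ≤ L)
    (hD : ∀ α β : ℝ, α ≤ β → |((Finset.univ.filter (fun i => x i ∈ Set.Icc α β)).card : ℝ) / n
      - ∫ t in α..β, ρ t| ≤ δ) :
    (∑ i, if x i = a then (0:ℝ) else Real.log |a - x i|) / n
      ≤ (∫ t in (-L)..L, Real.log |a - t| * ρ t)
        + (h * (1 + δ) + 2 * R * Real.exp (-K) + 2 * (M + K) * δ) := by
  have hL' : -L ≤ L := by linarith
  have hn' : (0:ℝ) < n := by exact_mod_cast hn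
  have hN' : (0 : ℝ) < N := by exact_mod_cast hN
  have hpos : 0 < h := by rw [hh]; exact div_pos hMK hN'
  have hρc' : ContinuousOn ρ (Set.uIcc (-L) L) := by rwa [Set.uIcc_of_le hL']
  have hρi : IntervalIntegrable ρ volume (-L) L := hρc'.intervalIntegrable
  -- Step 1: the empirical side
  have E := avg_log_le_of_discrepancy ρ x a hn hN hh hMK hK hM0 hLM hx ha hD
  -- Step 2: the level function integrates to the same main term
  have I1 := integral_level_fn_eq (M := M) (h := h) (a := a) (N := N) ρ
    (fun k => Real.exp (M - ((k:ℝ) + 1) * h)) hL' (fun k => Real.exp_pos _) hρoff hρi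
  -- Step 3: integrate the pointwise bound
  have hstep : IntervalIntegrable (fun t => M - h * ∑ k ∈ Finset.range N,
      (if t ∈ Set.Icc (a - Real.exp (M - ((k:ℝ) + 1) * h)) (a + Real.exp (M - ((k:ℝ) + 1) * h))
        then (1:ℝ) else 0)) volume (-L) L := by
    apply intervalIntegrable_const.sub
    apply IntervalIntegrable.const_mul
    have hI : ∀ k ∈ Finset.range N, IntervalIntegrable
        (fun t => if t ∈ Set.Icc (a - Real.exp (M - ((k:ℝ) + 1) * h))
          (a + Real.exp (M - ((k:ℝ) + 1) * h)) then (1:ℝ) else 0) volume (-L) L :=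
      fun k _ => intervalIntegrable_ite_Icc (ρ := fun _ => (1:ℝ)) hL' intervalIntegrable_const
    have h1 := IntervalIntegrable.sum (Finset.range N) hI
    have hfun : (∑ k ∈ Finset.range N, fun t => if t ∈ Set.Icc (a - Real.exp (M - ((k:ℝ) + 1) * h))
          (a + Real.exp (M - ((k:ℝ) + 1) * h)) then (1:ℝ) else 0)
        = fun t => ∑ k ∈ Finset.range N, (if t ∈ Set.Icc (a - Real.exp (M - ((k:ℝ) + 1) * h))
          (a + Real.exp (M - ((k:ℝ) + 1) * h)) then (1:ℝ) else 0) := by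
      ext t; simp only [Finset.sum_apply]
    rw [hfun] at h1; exact h1
  have f1 : IntervalIntegrable (fun t => Real.log |a - t| * ρ t) volume (-L) L :=
    (intervalIntegrable_log_abs_sub a _ _).mul_continuousOn hρc'
  have f2 : IntervalIntegrable (fun t => h * ρ t) volume (-L) L := hρi.const_mul h
  have f3 : IntervalIntegrable (fun t => max (-K - Real.log |a - t|) 0 * ρ t) volume (-L) L :=
    (intervalIntegrable_trunc K a _ _).mul_continuousOn hρc'
  have I2 : (∫ t in (-L)..L, (M - h * ∑ k ∈ Finset.range N,
        (if t ∈ Set.Icc (a - Real.exp (M - ((k:ℝ) + 1) * h)) (a + Real.exp (M - ((k:ℝ) + 1) * h))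
          then (1:ℝ) else 0)) * ρ t)
      ≤ ∫ t in (-L)..L, ((Real.log |a - t| * ρ t + h * ρ t)
          + max (-K - Real.log |a - t|) 0 * ρ t) := by
    apply intervalIntegral.integral_mono_on hL' (hstep.mul_continuousOn hρc') ((f1.add f2).add f3)
    intro t ht
    have hpt := level_fn_le (L := L) (a := a) hN hh hMK hK hLM ha ht
      (fun r hr hrM => level_le_max hN hh hMK hr hrM)
    have := mul_le_mul_of_nonneg_right hpt (hρ0 t)
    nlinarith [this]
  have I3 : (∫ t in (-L)..L, ((Real.log |a - t| * ρ t + h * ρ t)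
          + max (-K - Real.log |a - t|) 0 * ρ t))
      = (∫ t in (-L)..L, Real.log |a - t| * ρ t) + h * (∫ t in (-L)..L, ρ t)
        + ∫ t in (-L)..L, max (-K - Real.log |a - t|) 0 * ρ t := by
    rw [intervalIntegral.integral_add (f1.add f2) f3, intervalIntegral.integral_add f1 f2,
      intervalIntegral.integral_const_mul]
  have I4 := integral_trunc_le (K := K) (a := a) ρ hL' hR hρR hρc
  have I5 : (∫ t in (-L)..L, ρ t) ≤ 1 + δ := by
    have hall : (Finset.univ.filter (fun i => x i ∈ Set.Icc (-L) L)) = Finset.univ := by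
      apply Finset.filter_true_of_mem
      intro i _
      exact Set.mem_Icc.mpr (abs_le.mp (hx i))
    have := hD (-L) L hL'
    rw [hall, Finset.card_univ, Fintype.card_fin, div_self hn'.ne'] at this
    have := (abs_le.mp this).1
    linarith
  have I6 : h * (∫ t in (-L)..L, ρ t) ≤ h * (1 + δ) := mul_le_mul_of_nonneg_left I5 hpos.le
  rw [← I1] at E
  linarith

/-! ### The Kesten–McKay density -/

/-- The unnormalised Kesten–McKay density is nonnegative (everywhere, with Lean's conventions
`Real.sqrt x = 0` for `x ≤ 0` and `y / 0 = 0`). -/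
theorem km_density_nonneg (ℓ : ℕ) (hℓ : 2 ≤ ℓ) (t : ℝ) :
    0 ≤ ((ℓ : ℝ) + 1) * Real.sqrt (4 * ℓ - t ^ 2)
      / (2 * Real.pi * (((ℓ : ℝ) + 1) ^ 2 - t ^ 2)) := by
  by_cases h4 : 4 * (ℓ:ℝ) - t ^ 2 ≤ 0
  · rw [Real.sqrt_eq_zero_of_nonpos h4]; simp
  · push Not at h4
    have hℓ' : (2:ℝ) ≤ ℓ := by exact_mod_cast hℓ
    have h1 : 0 < ((ℓ : ℝ) + 1) ^ 2 - t ^ 2 := by nlinarith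
    have hden : 0 < 2 * Real.pi * (((ℓ : ℝ) + 1) ^ 2 - t ^ 2) :=
      mul_pos (mul_pos two_pos Real.pi_pos) h1
    exact div_nonneg (mul_nonneg (by positivity) (Real.sqrt_nonneg _)) hden.le

/-- The unnormalised Kesten–McKay density is bounded by `(ℓ+1) · 2√ℓ`. -/
theorem km_density_le (ℓ : ℕ) (hℓ : 2 ≤ ℓ) (t : ℝ) :
    ((ℓ : ℝ) + 1) * Real.sqrt (4 * ℓ - t ^ 2) / (2 * Real.pi * (((ℓ : ℝ) + 1) ^ 2 - t ^ 2))
      ≤ ((ℓ : ℝ) + 1) * (2 * Real.sqrt ℓ) := by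
  have hR : 0 ≤ ((ℓ : ℝ) + 1) * (2 * Real.sqrt ℓ) := by positivity
  by_cases h4 : 4 * (ℓ:ℝ) - t ^ 2 ≤ 0
  · rw [Real.sqrt_eq_zero_of_nonpos h4]; simpa using hR
  · push Not at h4
    have hℓ' : (2:ℝ) ≤ ℓ := by exact_mod_cast hℓ
    have hden1 : 1 ≤ 2 * Real.pi * (((ℓ : ℝ) + 1) ^ 2 - t ^ 2) := by
      have h1 : (1:ℝ) ≤ ((ℓ : ℝ) + 1) ^ 2 - t ^ 2 := by nlinarith
      have h2 : (1:ℝ) ≤ 2 * Real.pi := by linarith [Real.pi_gt_three]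
      nlinarith
    have hnum : ((ℓ : ℝ) + 1) * Real.sqrt (4 * ℓ - t ^ 2) ≤ ((ℓ : ℝ) + 1) * (2 * Real.sqrt ℓ) := by
      apply mul_le_mul_of_nonneg_left _ (by positivity)
      calc Real.sqrt (4 * ℓ - t ^ 2) ≤ Real.sqrt (4 * ℓ) := Real.sqrt_le_sqrt (by nlinarith)
        _ = 2 * Real.sqrt ℓ := by
          rw [Real.sqrt_mul (by norm_num : (0:ℝ) ≤ 4), show (4:ℝ) = 2 ^ 2 by norm_num,
            Real.sqrt_sq (by norm_num : (0:ℝ) ≤ 2)]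
    calc _ ≤ ((ℓ : ℝ) + 1) * Real.sqrt (4 * ℓ - t ^ 2) :=
          div_le_self (mul_nonneg (by positivity) (Real.sqrt_nonneg _)) hden1
      _ ≤ _ := hnum

/-- The unnormalised Kesten–McKay density vanishes off `(-2√ℓ, 2√ℓ)`. -/
theorem km_density_eq_zero (ℓ : ℕ) (t : ℝ)
    (ht : t ∉ Set.Ioo (-(2 * Real.sqrt ℓ)) (2 * Real.sqrt ℓ)) :
    ((ℓ : ℝ) + 1) * Real.sqrt (4 * ℓ - t ^ 2)
      / (2 * Real.pi * (((ℓ : ℝ) + 1) ^ 2 - t ^ 2)) = 0 := by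
  have hL : (2 * Real.sqrt ℓ) ^ 2 = 4 * ℓ := by
    rw [mul_pow, Real.sq_sqrt (Nat.cast_nonneg _)]; norm_num
  have habs : 2 * Real.sqrt ℓ ≤ |t| := by
    rw [Set.mem_Ioo, not_and_or, not_lt, not_lt] at ht
    rcases ht with h | h
    · linarith [neg_le_abs t]
    · exact h.trans (le_abs_self t)
  have h4 : 4 * (ℓ:ℝ) - t ^ 2 ≤ 0 := by
    have h1 : (2 * Real.sqrt ℓ) ^ 2 ≤ |t| ^ 2 := pow_le_pow_left₀ (by positivity) habs 2
    rw [sq_abs] at h1; linarith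
  rw [Real.sqrt_eq_zero_of_nonpos h4]; simp

/-- The unnormalised Kesten–McKay density is continuous on `[-2√ℓ, 2√ℓ]` (`ℓ ≥ 2`). -/
theorem km_density_continuousOn (ℓ : ℕ) (hℓ : 2 ≤ ℓ) :
    ContinuousOn (fun t : ℝ => ((ℓ : ℝ) + 1) * Real.sqrt (4 * ℓ - t ^ 2)
        / (2 * Real.pi * (((ℓ : ℝ) + 1) ^ 2 - t ^ 2)))
      (Set.Icc (-(2 * Real.sqrt ℓ)) (2 * Real.sqrt ℓ)) := by
  have hL : (2 * Real.sqrt ℓ) ^ 2 = 4 * ℓ := by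
    rw [mul_pow, Real.sq_sqrt (Nat.cast_nonneg _)]; norm_num
  have hℓ' : (2:ℝ) ≤ ℓ := by exact_mod_cast hℓ
  apply ContinuousOn.div
  · exact (continuous_const.mul (Real.continuous_sqrt.comp
      (continuous_const.sub (continuous_pow 2)))).continuousOn
  · exact (continuous_const.mul (continuous_const.sub (continuous_pow 2))).continuousOn
  · intro t ht
    have h1 : |t| ≤ 2 * Real.sqrt ℓ := abs_le.mpr ⟨ht.1, ht.2⟩
    have h2 : |t| ^ 2 ≤ (2 * Real.sqrt ℓ) ^ 2 := pow_le_pow_left₀ (abs_nonneg t) h1 2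
    rw [sq_abs, hL] at h2
    have h3 : 0 < ((ℓ:ℝ) + 1) ^ 2 - t ^ 2 := by nlinarith
    exact (mul_pos (mul_pos two_pos Real.pi_pos) h3).ne'


end DiscrepancyPotentialBound

/-! ### The route item -/

/-- **Serre's log-gas lemma** (item `stmt-ABC-2637`, decl
`Summit.ABC.ABC.Theses.RibetTakahashiSplit.DiscrepancyPotentialBound`): for `ℓ ≥ 2` and
`ε > 0` there is `δ > 0` such that any points `x₁,…,xₙ ∈ [-2√ℓ, 2√ℓ]` whose Kolmogorov
discrepancy to the (unnormalised) Kesten–McKay law is `≤ δ` on every closed interval satisfy,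
for every `|a| ≤ 2√ℓ`, `(1/n) Σ_{xᵢ ≠ a} log |a − xᵢ| ≤ U_ℓ(a) + ε`.  Proof: one-sided
discretised layer-cake (Koksma-type) comparison, see the module docstring. -/
theorem discrepancyPotentialBound_proof :
    Summit.ABC.ABC.Theses.RibetTakahashiSplit.DiscrepancyPotentialBound := by
  intro ℓ hℓ ε hε
  have hℓ' : (2:ℝ) ≤ ℓ := by exact_mod_cast hℓ
  -- constants
  set L : ℝ := 2 * Real.sqrt ℓ with hL_def
  have hsqrt1 : 1 ≤ Real.sqrt ℓ := by
    rw [show (1:ℝ) = Real.sqrt 1 from Real.sqrt_one.symm]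
    exact Real.sqrt_le_sqrt (by linarith)
  have hL1 : 1 ≤ 2 * L := by rw [hL_def]; linarith
  have hL0 : 0 ≤ L := by rw [hL_def]; positivity
  set R : ℝ := ((ℓ:ℝ) + 1) * (2 * Real.sqrt ℓ) with hR_def
  have hR0 : 0 < R := by rw [hR_def]; positivity
  set M : ℝ := Real.log (2 * L) + 1 with hM_def
  have hlog0 : 0 ≤ Real.log (2 * L) := Real.log_nonneg hL1
  have hM1 : 1 ≤ M := by rw [hM_def]; linarith
  set K : ℝ := max 0 (Real.log (8 * R / ε)) with hK_def
  have hK0 : 0 ≤ K := le_max_left _ _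
  have hMK : 0 < M + K := by linarith
  have hexp : 2 * R * Real.exp (-K) ≤ ε / 4 := by
    have h1 : Real.exp (-K) ≤ Real.exp (-Real.log (8 * R / ε)) :=
      Real.exp_le_exp.mpr (by linarith [le_max_right 0 (Real.log (8 * R / ε))])
    rw [Real.exp_neg (Real.log (8 * R / ε)), Real.exp_log (by positivity)] at h1
    calc 2 * R * Real.exp (-K) ≤ 2 * R * (8 * R / ε)⁻¹ := by gcongr
      _ = ε / 4 := by field_simp; ring
  set N : ℕ := ⌈8 * (M + K) / ε⌉₊ with hN_def
  have hN : 0 < N := Nat.ceil_pos.mpr (by positivity)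
  have hN' : (0:ℝ) < N := by exact_mod_cast hN
  have hNle : 8 * (M + K) / ε ≤ N := by rw [hN_def]; exact Nat.le_ceil _
  set h : ℝ := (M + K) / N with hh_def
  have hh0 : 0 ≤ h := by rw [hh_def]; positivity
  have hh8 : h ≤ ε / 8 := by
    rw [hh_def, div_le_iff₀ hN']
    calc M + K = (8 * (M + K) / ε) * (ε / 8) := by field_simp
      _ ≤ N * (ε / 8) := by gcongr
      _ = ε / 8 * N := by ring
  set δ : ℝ := min 1 (ε / (8 * (M + K))) with hδ_def
  have hδ0 : 0 < δ := lt_min one_pos (by positivity)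
  have hδ1 : δ ≤ 1 := min_le_left _ _
  have hδ2 : 2 * (M + K) * δ ≤ ε / 4 := by
    calc 2 * (M + K) * δ ≤ 2 * (M + K) * (ε / (8 * (M + K))) := by
          gcongr; exact min_le_right _ _
      _ = ε / 4 := by field_simp; ring
  refine ⟨δ, hδ0, ?_⟩
  intro n x hn hx hD a ha
  have main := DiscrepancyPotentialBound.avg_log_le_potential
    (fun t => ((ℓ : ℝ) + 1) * Real.sqrt (4 * ℓ - t ^ 2)
      / (2 * Real.pi * (((ℓ : ℝ) + 1) ^ 2 - t ^ 2)))
    x a hn hN hh_def hMK hK0 (by linarith) (by rw [hM_def]; linarith) hL0 hR0.le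
    (DiscrepancyPotentialBound.km_density_nonneg ℓ hℓ)
    (DiscrepancyPotentialBound.km_density_le ℓ hℓ)
    (DiscrepancyPotentialBound.km_density_eq_zero ℓ)
    (DiscrepancyPotentialBound.km_density_continuousOn ℓ hℓ) hx ha hD
  have hfin : h * (1 + δ) + 2 * R * Real.exp (-K) + 2 * (M + K) * δ ≤ ε := by
    have : h * (1 + δ) ≤ 2 * h := by nlinarith
    linarith
  linarith

end Summit.ABC.ABC.Theorems
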